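import Mathlib
import Summits.NavierStokesRegularity.NavierStokesRegularity.Theorems.TaoLadderRungTwoFlatInterfaceField
import HarnessLib

/-!
# The INTERFACE SHELL of the near/behind step: one-hop integration of the two interface deviations (theory-1 g48 numT61
  design P-61a, L-61a/L-61b, analytic half; helper for the K_A♭ parent item stmt-NavierStokesRegularity-22987
  `FlatGapCertificatesV2`, child 2A `GradedAdiabaticWakeA` of route TaoLadderRungTwoFlat; cell harvest/h2-tao-ladder, p1 g24;
  LADDER §61)

For two exact graded mirror flows `S` (hop flow) and `W` (reference flow) on `[0, τ]`, `u := S − W`, interface shell `n ≤ 0`: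

* `QuadPolar.hasDerivWithinAt_Ici_of_pseudoFlowOnShift_exact` — right derivatives of an exact flow on `[0, τ)` (incl. `s = 0`);
* `hasDerivAt_expRamp`, `expRamp_le` — the exponential ramp `(c/k)(e^{kx} − 1)` (antiderivative of the pump weight) and its
  end value against a link fact `e^{kT} − 1 ≤ I·kT`;
* `interface_carrier_le` — fencing (`image_norm_le_of_norm_deriv_right_le_deriv_boundary`) of the interface CARRIER deviation
  against the explicit boundary function built from `MirrorPulse.abs_quadTermOn_carrier_sub_le`, the pump source read from the
  near level `√(2V̄)·e^{θx/(2T)}` in the co-moving frame of speed `1/T`: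
  `|u₀(n,T)| ≤ |u₀(n,0)| + T·((2M+εM)I₁√(2V̄) + 2I₂V̄ + εI₁√(2V̄)R + εMR + ((2+ε)MB + B² + εMR + εRB))`
  (`∫₀ᵀ e^{θx/(2T)}dx = T·(2/θ)(e^{θ/2} − 1) ≤ T·I₁`, `∫₀ᵀ e^{θx/T}dx ≤ T·I₂`);
* `interface_bond_le` — the interface BOND deviation (no pump; constant slope `MirrorPulse.abs_quadTermOn_bond_sub_le`):
  `|u₁(n,T)| ≤ |u₁(n,0)| + T·((M + M₂ + R + ρ)B + (1+2ε)MR + εR² + (M + 2εM₂)ρ + ερ²)`.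

HONEST FRAMING: one-variable calculus about a MODEL lattice nonlinearity (Tao 2016 §4 vocabulary on `S♭`, graded mirror
table, `m = 2`); every level is a HYPOTHESIS; nothing certified about any orbit; no item closed; nothing about the
Navier–Stokes equations.
-/

noncomputable section

-- the sub-problem namespace repeats the summit name by design (D-0017)
set_option linter.dupNamespace false

namespace Summit.NavierStokesRegularity.NavierStokesRegularity.Theorems

open Set Finset Literature.Analysis.FluidPDE Literature.Analysis.FluidPDE.TaoCascade

/-! ### Calculus: right derivatives of exact flows, the exponential ramp, one-hop integration at the interface -/

namespace QuadPolar

variable {m : ℕ}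

/-- **An exact (`κ₁ = 0`) `PseudoFlowOnShift` flow has RIGHT derivatives `Q(S)` at every `s ∈ [0, τ)`** (including `s = 0`,
where only the one-sided derivative exists). [cite: Tao2016AveragedNS, §4 Lemma 4.1 (4.8); cell vocabulary, shift-set parametrised] -/
theorem hasDerivWithinAt_Ici_of_pseudoFlowOnShift_exact {𝕊 : Finset (ℤ × ℤ × ℤ)} {τ ε₀ : ℝ}
    {α : Fin m → Fin m → Fin m → ℤ × ℤ × ℤ → ℝ} {κ₂ : ℝ} {S₀ F₀ B₀ : Fin m → ℤ → ℝ}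
    {S F : Fin m → ℤ → ℝ → ℝ} (h : PseudoFlowOnShift 𝕊 τ ε₀ α 0 κ₂ S₀ F₀ B₀ S F) (i : Fin m) (k : ℤ) {s : ℝ}
    (hs : s ∈ Ico 0 τ) : HasDerivWithinAt (S i k) (quadTermOn 𝕊 ε₀ α S i k s) (Ici s) s := by
  have hsI : s ∈ Icc 0 τ := ⟨hs.1, hs.2.le⟩
  have hmot := h.motion i k s hsI
  rw [zero_mul, zero_mul] at hmot
  have heq : derivWithin (S i k) (Icc 0 τ) s = quadTermOn 𝕊 ε₀ α S i k s := by
    have := abs_nonpos_iff.mp hmot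
    linarith
  have hdiff : DifferentiableWithinAt ℝ (S i k) (Icc 0 τ) s :=
    (h.contDiffOn_S i k).differentiableOn (by norm_num) s hsI
  have hd : HasDerivWithinAt (S i k) (derivWithin (S i k) (Icc 0 τ) s) (Icc 0 τ) s := hdiff.hasDerivWithinAt
  rw [heq] at hd
  have hmem : Icc 0 τ ∈ nhdsWithin s (Ici s) := by
    have h1 : Icc s τ ∈ nhdsWithin s (Ici s) := Icc_mem_nhdsGE hs.2
    exact Filter.mem_of_superset h1 (Icc_subset_Icc hs.1 le_rfl)
  exact hd.mono_of_mem_nhdsWithin hmem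

end QuadPolar

namespace MirrorPulse

/-- derivative of the exponential ramp `x ↦ (c/k)(e^{kx} − 1)`: `c·e^{kx}` (`k ≠ 0`).
[folklore (one-variable calculus); cell LADDER §61 (pump integration)] -/
theorem hasDerivAt_expRamp (c k : ℝ) (hk : k ≠ 0) (x : ℝ) :
    HasDerivAt (fun x => c / k * (Real.exp (k * x) - 1)) (c * Real.exp (k * x)) x := by
  have h1 : HasDerivAt (fun x => k * x) k x := by simpa using (hasDerivAt_id x).const_mul k
  have h2 : HasDerivAt (fun x => Real.exp (k * x)) (Real.exp (k * x) * k) x := (Real.hasDerivAt_exp _).comp x h1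
  have h3 := (h2.sub_const 1).const_mul (c / k)
  have e : c / k * (Real.exp (k * x) * k) = c * Real.exp (k * x) := by field_simp
  rw [e] at h3
  exact h3

/-- the exponential ramp at its end: `(c/k)(e^{kT} − 1) ≤ c·T·I` when `(e^{kT} − 1) ≤ I·(kT)`, `0 < k`, `0 ≤ c`
(the integral `∫₀ᵀ c e^{kx} dx` against the link fact for `∫₀¹ e^{(kT)y} dy ≤ I`).
[folklore (one-variable calculus); cell LADDER §61 (link facts (I))] -/
theorem expRamp_le {c k T I : ℝ} (hc : 0 ≤ c) (hk : 0 < k) (hI : Real.exp (k * T) - 1 ≤ I * (k * T)) :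
    c / k * (Real.exp (k * T) - 1) ≤ c * T * I := by
  rw [div_mul_eq_mul_div, div_le_iff₀ hk]
  calc c * (Real.exp (k * T) - 1) ≤ c * (I * (k * T)) := mul_le_mul_of_nonneg_left hI hc
    _ = c * T * I * k := by ring

variable {ε ε₀ τ κ₂ κ₂' : ℝ} {W₀ FW₀ BW₀ S₀ FS₀ BS₀ : Fin 2 → ℤ → ℝ} {W FW S FS : Fin 2 → ℤ → ℝ → ℝ}

/-- **ONE-HOP INTEGRATION OF THE INTERFACE CARRIER** (L-61a, analytic half). Two exact graded mirror flows on `[0, τ]`, a time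
`0 < T ≤ τ`, the interface shell `n = 1−K ≤ 0`; on `[0, T]`: templates `≤ M` at `(1,n−1)`, `(0,n)`, `(1,n)`, interface levels
`|u₀(n)| ≤ R`, `|u₁(n)| ≤ B`, and the PUMP SOURCE read from the near level in the co-moving frame of speed `1/T`,
`|u₁(n−1, x)| ≤ √(2V̄)·e^{θx/(2T)}` (`0 < θ`); link facts `2(e^{θ/2} − 1) ≤ I₁θ`, `e^θ − 1 ≤ I₂θ`. Then
`|u₀(n, T)| ≤ |u₀(n, 0)| + T·((2M + εM)I₁√(2V̄) + 2I₂V̄ + εI₁√(2V̄)R + εMR + ((2+ε)MB + B² + εMR + εRB))`.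
[cite: Tao2016AveragedNS, §4 (4.8), §5 (continuity/integration step, statement shape); route TaoLadderRungTwoFlat, L-61a (cell LADDER §61, numT61 §3)] -/
theorem interface_carrier_le
    (hW : PseudoFlowOnShift shiftSetFlat τ ε₀ (mirrorTable ε ε) 0 κ₂ W₀ FW₀ BW₀ W FW)
    (hS : PseudoFlowOnShift shiftSetFlat τ ε₀ (mirrorTable ε ε) 0 κ₂' S₀ FS₀ BS₀ S FS)
    (hε : 0 ≤ ε) (hε₀ : 0 ≤ ε₀) {n : ℤ} (hn : n ≤ 0) {T θ M R B Vbar I₁ I₂ : ℝ} (hT : 0 < T) (hTτ : T ≤ τ)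
    (hθ : 0 < θ) (hM0 : 0 ≤ M) (hR0 : 0 ≤ R) (hV0 : 0 ≤ Vbar)
    (hM : ∀ x ∈ Icc 0 T, |W 1 (n - 1) x| ≤ M ∧ |W 0 n x| ≤ M ∧ |W 1 n x| ≤ M)
    (hν : ∀ x ∈ Icc 0 T, |(S - W) 1 (n - 1) x| ≤ Real.sqrt (2 * Vbar) * Real.exp (θ * x / (2 * T)))
    (hR : ∀ x ∈ Icc 0 T, |(S - W) 0 n x| ≤ R) (hB : ∀ x ∈ Icc 0 T, |(S - W) 1 n x| ≤ B)
    (hI₁ : 2 * (Real.exp (θ / 2) - 1) ≤ I₁ * θ) (hI₂ : Real.exp θ - 1 ≤ I₂ * θ) :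
    |(S - W) 0 n T| ≤ |(S - W) 0 n 0| + T * ((2 * M + ε * M) * I₁ * Real.sqrt (2 * Vbar) + 2 * I₂ * Vbar
      + ε * I₁ * Real.sqrt (2 * Vbar) * R + ε * M * R + ((2 + ε) * M * B + B ^ 2 + ε * M * R + ε * R * B)) := by
  -- data
  set k : ℝ := θ / (2 * T) with hk
  have hkpos : 0 < k := by rw [hk]; positivity
  have hk0 : k ≠ 0 := ne_of_gt hkpos
  have h2k0 : 2 * k ≠ 0 := by positivity
  set sV := Real.sqrt (2 * Vbar) with hsV
  have hsV0 : 0 ≤ sV := Real.sqrt_nonneg _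
  set a₁ : ℝ := (2 * M + ε * (M + R)) * sV with ha₁
  have ha₁0 : 0 ≤ a₁ := by rw [ha₁]; positivity
  set cC : ℝ := ε * M * R + ((2 + ε) * M * B + B ^ 2 + ε * M * R + ε * R * B) with hcC
  set d0 : ℝ := |(S - W) 0 n 0| with hd0
  -- the boundary function and its derivative
  set Φ : ℝ → ℝ := fun x => d0 + cC * x + a₁ / k * (Real.exp (k * x) - 1)
    + (2 * Vbar) / (2 * k) * (Real.exp ((2 * k) * x) - 1) with hΦ
  set Φ' : ℝ → ℝ := fun x => cC + a₁ * Real.exp (k * x) + (2 * Vbar) * Real.exp ((2 * k) * x) with hΦ'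
  have hΦd : ∀ x, HasDerivAt Φ (Φ' x) x := by
    intro x
    have h1 : HasDerivAt (fun x => d0 + cC * x) cC x := by
      simpa using ((hasDerivAt_id x).const_mul cC).const_add d0
    have h2 := hasDerivAt_expRamp a₁ k hk0 x
    have h3 := hasDerivAt_expRamp (2 * Vbar) (2 * k) h2k0 x
    have h := (h1.add h2).add h3
    exact h
  -- the deviation: continuity and right derivatives on `[0, T)`
  have hsub : Icc 0 T ⊆ Icc 0 τ := Icc_subset_Icc le_rfl hTτ
  have hcont : ContinuousOn ((S - W) 0 n) (Icc 0 T) := by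
    have hS' := (QuadPolar.continuousOn_of_pseudoFlowOnShift hS 0 n).mono hsub
    have hW' := (QuadPolar.continuousOn_of_pseudoFlowOnShift hW 0 n).mono hsub
    have e : (S - W) 0 n = fun s => S 0 n s - W 0 n s := by funext s; simp
    rw [e]; exact hS'.sub hW'
  have hder : ∀ x ∈ Ico 0 T, HasDerivWithinAt ((S - W) 0 n)
      (quadTermOn shiftSetFlat ε₀ (mirrorTable ε ε) S 0 n x - quadTermOn shiftSetFlat ε₀ (mirrorTable ε ε) W 0 n x)
      (Ici x) x := by
    intro x hx
    have hx' : x ∈ Ico 0 τ := ⟨hx.1, hx.2.trans_le hTτ⟩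
    have h := (QuadPolar.hasDerivWithinAt_Ici_of_pseudoFlowOnShift_exact hS 0 n hx').sub
      (QuadPolar.hasDerivWithinAt_Ici_of_pseudoFlowOnShift_exact hW 0 n hx')
    have e : (S - W) 0 n = fun s => S 0 n s - W 0 n s := by funext s; simp
    rw [e]; exact h
  -- the pointwise derivative bound
  have hbound : ∀ x ∈ Ico 0 T,
      ‖quadTermOn shiftSetFlat ε₀ (mirrorTable ε ε) S 0 n x - quadTermOn shiftSetFlat ε₀ (mirrorTable ε ε) W 0 n x‖
        ≤ Φ' x := by
    intro x hx
    have hxI : x ∈ Icc 0 T := ⟨hx.1, hx.2.le⟩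
    obtain ⟨hW1', hW0, hW1⟩ := hM x hxI
    set ν := sV * Real.exp (k * x) with hνdef
    have hνx : |(S - W) 1 (n - 1) x| ≤ ν := by
      have := hν x hxI
      have e : θ * x / (2 * T) = k * x := by rw [hk]; ring
      rwa [e] at this
    have h := abs_quadTermOn_carrier_sub_le hε hε₀ hn hW1' hW0 hW1 hνx (hR x hxI) (hB x hxI)
    rw [Real.norm_eq_abs]
    refine h.trans (le_of_eq ?_)
    have hν2 : ν * ν = 2 * Vbar * Real.exp ((2 * k) * x) := by
      rw [hνdef, hsV]
      have e2 : Real.exp ((2 * k) * x) = Real.exp (k * x) * Real.exp (k * x) := by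
        rw [← Real.exp_add]; ring_nf
      rw [e2]
      have hs : Real.sqrt (2 * Vbar) * Real.sqrt (2 * Vbar) = 2 * Vbar := Real.mul_self_sqrt (by positivity)
      calc Real.sqrt (2 * Vbar) * Real.exp (k * x) * (Real.sqrt (2 * Vbar) * Real.exp (k * x))
          = (Real.sqrt (2 * Vbar) * Real.sqrt (2 * Vbar)) * (Real.exp (k * x) * Real.exp (k * x)) := by ring
        _ = 2 * Vbar * (Real.exp (k * x) * Real.exp (k * x)) := by rw [hs]
    simp only [hΦ', ha₁, hcC]
    rw [hνdef] at hν2 ⊢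
    nlinarith [hν2]
  -- fencing
  have hΦ0 : ‖(S - W) 0 n 0‖ ≤ Φ 0 := by
    simp only [hΦ, mul_zero, Real.exp_zero, sub_self, add_zero, Real.norm_eq_abs, hd0]; exact le_rfl
  have hfence := image_norm_le_of_norm_deriv_right_le_deriv_boundary hcont hder hΦ0 hΦd hbound
    (right_mem_Icc.mpr hT.le)
  rw [Real.norm_eq_abs] at hfence
  refine hfence.trans ?_
  -- evaluate the boundary function at `T`: `kT = θ/2`, `2kT = θ`
  have hkT : k * T = θ / 2 := by rw [hk]; field_simp
  have h2kT : (2 * k) * T = θ := by rw [hk]; field_simp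
  have hr1 : a₁ / k * (Real.exp (k * T) - 1) ≤ a₁ * T * I₁ := by
    refine expRamp_le ha₁0 hkpos ?_
    rw [hkT]
    have : I₁ * (θ / 2) = (I₁ * θ) / 2 := by ring
    rw [this]; linarith
  have hr2 : (2 * Vbar) / (2 * k) * (Real.exp ((2 * k) * T) - 1) ≤ (2 * Vbar) * T * I₂ := by
    refine expRamp_le (by positivity) (by positivity) ?_
    rw [h2kT]; exact hI₂
  simp only [hΦ]
  have htot : d0 + cC * T + a₁ / k * (Real.exp (k * T) - 1) + (2 * Vbar) / (2 * k) * (Real.exp ((2 * k) * T) - 1)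
      ≤ d0 + cC * T + a₁ * T * I₁ + (2 * Vbar) * T * I₂ := by linarith
  refine htot.trans (le_of_eq ?_)
  simp only [hcC, ha₁, hsV]
  ring

/-- **ONE-HOP INTEGRATION OF THE INTERFACE BOND** (L-61b, analytic half): on `[0, T]` (`0 < T ≤ τ`, shell `n ≤ 0`), interface
levels `|u₀(n)| ≤ R`, `|u₁(n)| ≤ B`, carrier deviation one shell deeper `|u₀(n+1)| ≤ ρ`, templates `|W₀(n)|, |W₁(n)| ≤ M`,
`|W₀(n+1)| ≤ M₂` give `|u₁(n, T)| ≤ |u₁(n, 0)| + T·((M + M₂ + R + ρ)B + (1+2ε)MR + εR² + (M + 2εM₂)ρ + ερ²)`.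
[cite: Tao2016AveragedNS, §4 (4.8), §5 (statement shape); route TaoLadderRungTwoFlat, L-61b (cell LADDER §61, numT61 §3)] -/
theorem interface_bond_le
    (hW : PseudoFlowOnShift shiftSetFlat τ ε₀ (mirrorTable ε ε) 0 κ₂ W₀ FW₀ BW₀ W FW)
    (hS : PseudoFlowOnShift shiftSetFlat τ ε₀ (mirrorTable ε ε) 0 κ₂' S₀ FS₀ BS₀ S FS)
    (hε : 0 ≤ ε) (hε₀ : 0 ≤ ε₀) {n : ℤ} (hn : n ≤ 0) {T M M₂ R B ρ : ℝ} (hT : 0 < T) (hTτ : T ≤ τ)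
    (hM : ∀ x ∈ Icc 0 T, |W 0 n x| ≤ M ∧ |W 1 n x| ≤ M ∧ |W 0 (n + 1) x| ≤ M₂)
    (hR : ∀ x ∈ Icc 0 T, |(S - W) 0 n x| ≤ R) (hB : ∀ x ∈ Icc 0 T, |(S - W) 1 n x| ≤ B)
    (hρ : ∀ x ∈ Icc 0 T, |(S - W) 0 (n + 1) x| ≤ ρ) :
    |(S - W) 1 n T| ≤ |(S - W) 1 n 0|
      + T * ((M + M₂ + R + ρ) * B + (1 + 2 * ε) * M * R + ε * R ^ 2 + (M + 2 * ε * M₂) * ρ + ε * ρ ^ 2) := by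
  set C : ℝ := (M + M₂ + R + ρ) * B + (1 + 2 * ε) * M * R + ε * R ^ 2 + (M + 2 * ε * M₂) * ρ + ε * ρ ^ 2 with hC
  have hsub : Icc 0 T ⊆ Icc 0 τ := Icc_subset_Icc le_rfl hTτ
  have hcont : ContinuousOn ((S - W) 1 n) (Icc 0 T) := by
    have hS' := (QuadPolar.continuousOn_of_pseudoFlowOnShift hS 1 n).mono hsub
    have hW' := (QuadPolar.continuousOn_of_pseudoFlowOnShift hW 1 n).mono hsub
    have e : (S - W) 1 n = fun s => S 1 n s - W 1 n s := by funext s; simp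
    rw [e]; exact hS'.sub hW'
  have hder : ∀ x ∈ Ico 0 T, HasDerivWithinAt ((S - W) 1 n)
      (quadTermOn shiftSetFlat ε₀ (mirrorTable ε ε) S 1 n x - quadTermOn shiftSetFlat ε₀ (mirrorTable ε ε) W 1 n x)
      (Ici x) x := by
    intro x hx
    have hx' : x ∈ Ico 0 τ := ⟨hx.1, hx.2.trans_le hTτ⟩
    have h := (QuadPolar.hasDerivWithinAt_Ici_of_pseudoFlowOnShift_exact hS 1 n hx').sub
      (QuadPolar.hasDerivWithinAt_Ici_of_pseudoFlowOnShift_exact hW 1 n hx')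
    have e : (S - W) 1 n = fun s => S 1 n s - W 1 n s := by funext s; simp
    rw [e]; exact h
  have hbound : ∀ x ∈ Ico 0 T,
      ‖quadTermOn shiftSetFlat ε₀ (mirrorTable ε ε) S 1 n x - quadTermOn shiftSetFlat ε₀ (mirrorTable ε ε) W 1 n x‖
        ≤ C := by
    intro x hx
    have hxI : x ∈ Icc 0 T := ⟨hx.1, hx.2.le⟩
    obtain ⟨hW0, hW1, hW0'⟩ := hM x hxI
    rw [Real.norm_eq_abs]
    exact abs_quadTermOn_bond_sub_le hε hε₀ hn hW0 hW1 hW0' (hR x hxI) (hB x hxI) (hρ x hxI)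
  have h := norm_image_sub_le_of_norm_deriv_right_le_segment hcont hder hbound T (right_mem_Icc.mpr hT.le)
  rw [Real.norm_eq_abs, sub_zero] at h
  have htri : |(S - W) 1 n T| ≤ |(S - W) 1 n 0| + |(S - W) 1 n T - (S - W) 1 n 0| := by
    have := abs_add_le ((S - W) 1 n 0) ((S - W) 1 n T - (S - W) 1 n 0)
    rwa [add_sub_cancel] at this
  calc |(S - W) 1 n T| ≤ |(S - W) 1 n 0| + |(S - W) 1 n T - (S - W) 1 n 0| := htri
    _ ≤ |(S - W) 1 n 0| + C * T := add_le_add le_rfl h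
    _ = |(S - W) 1 n 0| + T * C := by ring

end MirrorPulse

end Summit.NavierStokesRegularity.NavierStokesRegularity.Theorems

end
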